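import Mathlib.Geometry.Manifold.MFDeriv.Basic
import Mathlib.Geometry.Manifold.Diffeomorph
import Mathlib.Geometry.Manifold.LocalDiffeomorph
import Mathlib.LinearAlgebra.BilinearForm.IsometryEquiv
import Mathlib.LinearAlgebra.FiniteDimensional.Lemmas
import Mathlib.Topology.Algebra.Module.Spaces.ContinuousLinearMap
import Literature.Geometry.Lorentzian.PseudoRiemannianMetric
import Literature.Geometry.Lorentzian.LorentzianMetric
import HarnessLib

-- provenance: harness21/H21/H21/Prelude/Lorentz/Isometry.lean @ 7df6307 (interim HEAD d8f2665); M5 mechanical rewrite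
/-!
# Pullback of fibrewise bilinear forms, isometries (trunk G08 = T-LORENTZ, item C8)

Let `N` be a manifold modelled on `I' : ModelWithCorners ℝ E' H'`, `M` a manifold modelled on
`I : ModelWithCorners ℝ E H`, and `f : N → M`. For a family of continuous bilinear forms
`b x : T_x M →L[ℝ] T_x M →L[ℝ] ℝ` on the tangent spaces of `M`, the **pullback**
`pullbackBilin f b y := b (f y) (df_y ·, df_y ·)` is a family of continuous bilinear forms on the
tangent spaces of `N` (`df_y = mfderiv I' I f y`). With it we define, for pseudo-Riemannian
metrics `gN` on `TN` and `gM` on `TM`: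

* `PseudoRiemannianMetric.IsIsometricImmersion gN f gM` (`f` is `C^n` and `f^* gM = gN`),
  `PseudoRiemannianMetric.IsLocalIsometry` (moreover a local diffeomorphism, Mathlib's
  `IsLocalDiffeomorph`), `PseudoRiemannianMetric.IsIsometry Φ gN gM` for a diffeomorphism
  `Φ : Diffeomorph I' I N M m`;
* `TimeOrientation.PreservesTimeOrientation f τN τM` (`df` maps the orienting field of `N` to
  future-directed vectors of `M`);
* the pulled-back metrics `PseudoRiemannianMetric.comap`, `LorentzianMetric.comap` along a
  `C^{n+1}` immersion between manifolds of the same dimension (a local diffeomorphism), and the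
  pulled-back time orientation `TimeOrientation.comap`.

## Mathlib

Mathlib has no pullback of bundle metrics / fibrewise bilinear forms along smooth maps
(`rg -i 'pullback|isometr' Mathlib/Geometry/Manifold` only finds pullbacks of vector *fields*
and of vector bundles). Fibrewise, `pullbackBilin` is `LinearMap.BilinForm.comp B df df`, and an
isometry at a point is a Mathlib `LinearMap.BilinForm.IsometryEquiv`
(`Mathlib/LinearAlgebra/BilinearForm/IsometryEquiv.lean`); we use the continuous-linear version
built from `ContinuousLinearMap.precomp`/`ContinuousLinearMap.comp` (the tangent spaces are only
topological vector spaces, so `ContinuousLinearMap.bilinearComp` does not apply). We use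
Mathlib's `mfderiv`, `Diffeomorph`, `IsLocalDiffeomorph`, `LinearEquiv.ofBijective` and
`LinearMap.injective_iff_surjective_of_finrank_eq_finrank`.

## Design choices

* Regularity: the pullback of a `C^n` metric along `f` involves `df`, so it is `C^n` only when
  `f` is `C^{n+1}`; the `comap` constructions therefore take `hf : ContMDiff I' I (n + 1) f`
  (for `n = ∞, ω` this is `C^∞`, `C^ω`). The *predicates* `IsIsometricImmersion` etc. only ask
  `f` to be `C^n`, as in the outline.
* `comap` is defined for immersions between manifolds of equal (finite) dimension
  (`hf' : ∀ y, Injective (mfderiv I' I f y)`, `hdim : finrank ℝ E' = finrank ℝ E`), i.e. local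
  diffeomorphisms; then every `df_y` is a linear isomorphism (`mfderiv_bijective_of_injective`),
  which gives nondegeneracy and the Lorentzian signature of the pullback without `sorry`. Only
  the smoothness statements `contMDiff_pullbackBilin` and `TimeOrientation.contMDiff_comapFun`
  (both true under the stated hypotheses) are recorded as named facts and threaded as the
  hypotheses `hpb`, `hcf` of the `comap` constructions.
* **Downstream note (M5 migration).** `PseudoRiemannianMetric.comap`, `LorentzianMetric.comap`,
  `TimeOrientation.comap` and their API lemmas now take `hpb : contMDiff_pullbackBilin I M I' N n`
  (and `hcf : τ.contMDiff_comapFun I' N`) as explicit hypotheses; both facts carry their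
  `IsManifold`/`FiniteDimensional` hypotheses as inner instance binders. The importer
  `Literature.Geometry.Lorentzian.Hypersurface` (`inducedRiemannianMetric`, which applied
  `contMDiff_pullbackBilin` as a theorem) must take `hpb` as a hypothesis and write
  `hpb f hf.contMDiff g`; the other importers only use `pullbackBilin`/`pullbackBilin_id`
  (unchanged). The intended pattern is to thread the fact, not to quantify it inside statements.
* No global `FiniteDimensional ℝ (TangentSpace I x)` instance: obtained locally by
  `inferInstanceAs (FiniteDimensional ℝ E)`.

## References

* B. O'Neill, *Semi-Riemannian geometry with applications to relativity*, Academic Press 1983,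
  Ch. 3, pp. 58–59 (isometries), Def. 3.9 ff. (pullback of tensors), pp. 90–91 (local
  isometries, semi-Riemannian coverings), Ch. 5, p. 145 (time orientation).
-/

open Manifold Bundle
open scoped ContDiff Topology

noncomputable section

namespace Literature.Geometry.Lorentzian

variable {E : Type*} [NormedAddCommGroup E] [NormedSpace ℝ E] {H : Type*} [TopologicalSpace H]
  {I : ModelWithCorners ℝ E H} {M : Type*} [TopologicalSpace M] [ChartedSpace H M]
  {E' : Type*} [NormedAddCommGroup E'] [NormedSpace ℝ E'] {H' : Type*} [TopologicalSpace H']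
  {I' : ModelWithCorners ℝ E' H'} {N : Type*} [TopologicalSpace N] [ChartedSpace H' N]
  {E'' : Type*} [NormedAddCommGroup E''] [NormedSpace ℝ E''] {H'' : Type*}
  [TopologicalSpace H''] {I'' : ModelWithCorners ℝ E'' H''} {P : Type*} [TopologicalSpace P]
  [ChartedSpace H'' P] {n : ℕ∞ω} {m : ℕ∞ω}

/-! ### Pullback of fibrewise bilinear forms -/

/-- The **pullback** `f^* b` along `f : N → M` of a family `b` of continuous bilinear forms on
the tangent spaces of `M`: `(f^* b)_y (v, w) = b_{f y} (df_y v, df_y w)` with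
`df_y = mfderiv I' I f y`. If `f` is not differentiable at `y`, `df_y = 0` (Mathlib's junk
value) and `(f^* b)_y = 0`. O'Neill 1983, Ch. 3, Def. 3.9 and p. 58. Fibrewise this is
`LinearMap.BilinForm.comp (b (f y)) df_y df_y`. [cite: ONeill1983, Ch. 3, Def. 3.9 and p. 58] -/
def pullbackBilin (f : N → M) (b : Π x : M, TangentSpace I x →L[ℝ] TangentSpace I x →L[ℝ] ℝ)
    (y : N) : TangentSpace I' y →L[ℝ] TangentSpace I' y →L[ℝ] ℝ :=
  (ContinuousLinearMap.precomp ℝ (mfderiv I' I f y)).comp ((b (f y)).comp (mfderiv I' I f y))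

/-- `(f^* b)_y (v, w) = b_{f y} (df_y v, df_y w)`. O'Neill 1983, Ch. 3, Def. 3.9. [cite: ONeill1983, Ch. 3, Def. 3.9] -/
@[simp]
lemma pullbackBilin_apply (f : N → M)
    (b : Π x : M, TangentSpace I x →L[ℝ] TangentSpace I x →L[ℝ] ℝ) (y : N)
    (v w : TangentSpace I' y) :
    pullbackBilin (I := I) (I' := I') f b y v w = b (f y) (mfderiv I' I f y v) (mfderiv I' I f y w) :=
  rfl

/-- Pullback along the identity is the identity: `id^* b = b`. O'Neill 1983, Ch. 3, p. 58. [cite: ONeill1983, Ch. 3, p. 58] -/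
@[simp]
lemma pullbackBilin_id
    (b : Π x : M, TangentSpace I x →L[ℝ] TangentSpace I x →L[ℝ] ℝ) :
    pullbackBilin (I := I) (I' := I) (id : M → M) b = b := by
  funext x
  ext v w
  rw [pullbackBilin_apply, mfderiv_id]
  rfl

/-- **Chain rule** for pullbacks: `(g ∘ f)^* b = f^* (g^* b)` for differentiable `f`, `g`
(Mathlib `mfderiv_comp`). O'Neill 1983, Ch. 3, p. 58 (functoriality of pullback). [cite: ONeill1983, Ch. 3, p. 58] -/
theorem pullbackBilin_comp {f : N → M} {g : M → P} (hg : MDifferentiable I I'' g)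
    (hf : MDifferentiable I' I f) (b : Π z : P, TangentSpace I'' z →L[ℝ] TangentSpace I'' z →L[ℝ] ℝ) :
    pullbackBilin (I := I'') (I' := I') (g ∘ f) b =
      pullbackBilin (I := I) (I' := I') f (pullbackBilin (I := I'') (I' := I) g b) := by
  funext y
  ext v w
  simp only [pullbackBilin_apply, Function.comp_apply]
  rw [mfderiv_comp y (hg (f y)) (hf y)]
  rfl

/-- The pullback of a fibrewise symmetric family is fibrewise symmetric. [folklore] -/
lemma pullbackBilin_symm (f : N → M)
    (b : Π x : M, TangentSpace I x →L[ℝ] TangentSpace I x →L[ℝ] ℝ)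
    (hb : ∀ x v w, b x v w = b x w v) (y : N) (v w : TangentSpace I' y) :
    pullbackBilin (I := I) (I' := I') f b y v w = pullbackBilin (I := I) (I' := I') f b y w v := by
  simp [hb]

/-! ### Differentials of equidimensional immersions -/

/-- An injective differential `df_y : T_y N → T_{f y} M` between manifolds whose (finite
dimensional) model spaces have the same dimension is bijective (rank–nullity). This is the
pointwise content of "immersion between equidimensional manifolds = local diffeomorphism".
O'Neill 1983, Ch. 1, Lemma 1.31 ff.; Ch. 3, p. 90. [cite: ONeill1983, Ch. 1, Lemma 1.31] -/
theorem mfderiv_bijective_of_injective [FiniteDimensional ℝ E] [FiniteDimensional ℝ E']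
    {f : N → M} {y : N} (hf' : Function.Injective (mfderiv I' I f y))
    (hdim : Module.finrank ℝ E' = Module.finrank ℝ E) :
    Function.Bijective (mfderiv I' I f y) := by
  haveI : FiniteDimensional ℝ (TangentSpace I' y) := inferInstanceAs (FiniteDimensional ℝ E')
  haveI : FiniteDimensional ℝ (TangentSpace I (f y)) := inferInstanceAs (FiniteDimensional ℝ E)
  refine ⟨hf', ?_⟩
  have h := (LinearMap.injective_iff_surjective_of_finrank_eq_finrank
    (f := (mfderiv I' I f y).toLinearMap) hdim).mp hf'
  exact h

/-- The differential of an equidimensional immersion at `y`, as a linear equivalence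
`T_y N ≃ₗ[ℝ] T_{f y} M` (`LinearEquiv.ofBijective` applied to `mfderiv_bijective_of_injective`).
O'Neill 1983, Ch. 3, p. 90. [cite: ONeill1983, Ch. 3, p. 90] -/
def mfderivEquivOfInjective [FiniteDimensional ℝ E] [FiniteDimensional ℝ E']
    (f : N → M) (y : N) (hf' : Function.Injective (mfderiv I' I f y))
    (hdim : Module.finrank ℝ E' = Module.finrank ℝ E) :
    TangentSpace I' y ≃ₗ[ℝ] TangentSpace I (f y) :=
  LinearEquiv.ofBijective (mfderiv I' I f y).toLinearMap (mfderiv_bijective_of_injective hf' hdim)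

/-- `mfderivEquivOfInjective` is `df_y` as a function. [folklore] -/
@[simp]
lemma mfderivEquivOfInjective_apply [FiniteDimensional ℝ E] [FiniteDimensional ℝ E']
    (f : N → M) (y : N) (hf' : Function.Injective (mfderiv I' I f y))
    (hdim : Module.finrank ℝ E' = Module.finrank ℝ E) (v : TangentSpace I' y) :
    mfderivEquivOfInjective (I := I) (I' := I') f y hf' hdim v = mfderiv I' I f y v :=
  rfl

/-- `df_y (df_y⁻¹ w) = w` for the inverse of `mfderivEquivOfInjective`. [folklore] -/
@[simp]
lemma mfderiv_mfderivEquivOfInjective_symm [FiniteDimensional ℝ E] [FiniteDimensional ℝ E']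
    (f : N → M) (y : N) (hf' : Function.Injective (mfderiv I' I f y))
    (hdim : Module.finrank ℝ E' = Module.finrank ℝ E) (w : TangentSpace I (f y)) :
    mfderiv I' I f y ((mfderivEquivOfInjective (I := I) (I' := I') f y hf' hdim).symm w) = w :=
  (mfderivEquivOfInjective (I := I) (I' := I') f y hf' hdim).apply_symm_apply w

/-! ### Isometric immersions, local isometries, isometries -/

variable [IsManifold I' ∞ N] [IsManifold I ∞ M]

namespace PseudoRiemannianMetric

variable (gN : PseudoRiemannianMetric I' n E' (TangentSpace I' : N → Type _))
  (gM : PseudoRiemannianMetric I n E (TangentSpace I : M → Type _))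

/-- `f : N → M` is an **isometric immersion** from `(N, gN)` to `(M, gM)`: `f` is `C^n` and
`f^* gM = gN`, i.e. `gM (df v, df w) = gN (v, w)` for all tangent vectors (this forces every
`df_y` to be injective, by nondegeneracy of `gN`). O'Neill 1983, Ch. 3, p. 58 and Ch. 4,
pp. 97–98 (semi-Riemannian submanifolds and isometric immersions). [cite: ONeill1983, Ch. 3, p. 58 and Ch. 4, pp. 97–98] -/
def IsIsometricImmersion (f : N → M) : Prop :=
  ContMDiff I' I n f ∧ ∀ y, pullbackBilin (I := I) (I' := I') f gM.val y = gN.val y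

/-- `f : N → M` is a **local isometry** from `(N, gN)` to `(M, gM)`: a `C^n` local
diffeomorphism (Mathlib's `IsLocalDiffeomorph I' I n f`) with `f^* gM = gN`. O'Neill 1983,
Ch. 3, pp. 90–91. [cite: ONeill1983, Ch. 3, pp. 90–91] -/
def IsLocalIsometry (f : N → M) : Prop :=
  IsLocalDiffeomorph I' I n f ∧ ∀ y, pullbackBilin (I := I) (I' := I') f gM.val y = gN.val y

variable {gN gM} in
/-- A local isometry is an isometric immersion. O'Neill 1983, Ch. 3, p. 90. [cite: ONeill1983, Ch. 3, p. 90] -/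
lemma IsLocalIsometry.isIsometricImmersion {f : N → M} (hf : IsLocalIsometry gN gM f) :
    IsIsometricImmersion gN gM f :=
  ⟨hf.1.contMDiff, hf.2⟩

/-- A diffeomorphism `Φ : N ≃ M` (of class `C^m`) is an **isometry** from `(N, gN)` onto
`(M, gM)` if `Φ^* gM = gN`, i.e. every differential `dΦ_y` is a linear isometry
`(T_y N, gN_y) → (T_{Φ y} M, gM_{Φ y})` (fibrewise a `LinearMap.BilinForm.IsometryEquiv`).
O'Neill 1983, Ch. 3, Def. 3.4 (p. 58). [cite: ONeill1983, Ch. 3, Def. 3.4 (p. 58)] -/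
def IsIsometry (Φ : Diffeomorph I' I N M m) : Prop :=
  ∀ y, pullbackBilin (I := I) (I' := I') Φ gM.val y = gN.val y

variable {gN gM} in
/-- An isometry of class `C^n` is a local isometry. O'Neill 1983, Ch. 3, p. 90. [cite: ONeill1983, Ch. 3, p. 90] -/
lemma IsIsometry.isLocalIsometry {Φ : Diffeomorph I' I N M n} (hΦ : IsIsometry gN gM Φ) :
    IsLocalIsometry gN gM Φ :=
  ⟨Φ.isLocalDiffeomorph, hΦ⟩

/-- The identity diffeomorphism is an isometry. O'Neill 1983, Ch. 3, p. 58. [cite: ONeill1983, Ch. 3, p. 58] -/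
lemma isIsometry_refl : IsIsometry gM gM (Diffeomorph.refl I M m) := fun y ↦ by
  have : (⇑(Diffeomorph.refl I M m) : M → M) = id := rfl
  rw [this, pullbackBilin_id]

end PseudoRiemannianMetric

/-! ### Time-orientation preserving maps -/

namespace TimeOrientation

variable {gN : LorentzianMetric I' n N} {gM : LorentzianMetric I n M}

/-- A map `f : N → M` between time-oriented Lorentzian manifolds **preserves time
orientation** if its differential sends the future-directed orienting vector field `τN` of `N`
to future-directed (causal) vectors of `(M, τM)`: `df_y (τN y)` is causal and
`gM (τM (f y), df_y (τN y)) < 0`. O'Neill 1983, Ch. 5, p. 145; Hawking–Ellis 1973, §3.1. [cite: ONeill1983, Ch. 5, p. 145] -/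
def PreservesTimeOrientation (f : N → M) (τN : TimeOrientation gN) (τM : TimeOrientation gM) :
    Prop :=
  ∀ y, τM.IsFutureDirected (mfderiv I' I f y (τN.vectorField y))

end TimeOrientation

/-! ### Pulling back metrics and time orientations along local diffeomorphisms -/

section Comap

namespace PseudoRiemannianMetric

variable (I I' M N n) in
/-- Smoothness of the pullback: if `g` is a `C^n` section of the bundle of bilinear forms on
`TM` and `f : N → M` is `C^{n+1}`, then `f^* g` is a `C^n` section of the bundle of bilinear
forms on `TN` (in charts, `f^* g = (Df)ᵀ (g ∘ f) (Df)` with `Df` of class `C^n`).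
O'Neill 1983, Ch. 3, Def. 3.9 and Lemma 3.35 ff.  The manifold hypotheses are part of the
statement (inner instance binders); `I M I' N n` are explicit. [cite: ONeill1983, Ch. 3, Def. 3.9 and Lemma 3.35] -/
def contMDiff_pullbackBilin : Prop :=
  ∀ [IsManifold I' ∞ N] [IsManifold I ∞ M]
    (f : N → M) (_ : ContMDiff I' I (n + 1) f) (g : PseudoRiemannianMetric I n E (TangentSpace I : M → Type _)),
    ContMDiff I' (I'.prod 𝓘(ℝ, E' →L[ℝ] E' →L[ℝ] ℝ)) n
      (fun y : N ↦ TotalSpace.mk' (E' →L[ℝ] E' →L[ℝ] ℝ)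
        (E := fun y : N ↦ TangentSpace I' y →L[ℝ] TangentSpace I' y →L[ℝ] ℝ) y
        (pullbackBilin (I := I) (I' := I') f g.val y))

variable [FiniteDimensional ℝ E] [FiniteDimensional ℝ E']

/-- The **pullback metric** `f^* g` of a `C^n` pseudo-Riemannian metric `g` on `TM` along a
`C^{n+1}` immersion `f : N → M` between manifolds of the same dimension (a local
diffeomorphism): `(f^* g)_y (v, w) = g_{f y} (df_y v, df_y w)`. Nondegeneracy holds because each
`df_y` is a linear isomorphism. O'Neill 1983, Ch. 3, p. 58 and pp. 90–91 (a local
diffeomorphism onto a semi-Riemannian manifold pulls back a unique metric making it a local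
isometry). Smoothness of the pullback, `contMDiff_pullbackBilin`, is the hypothesis `hpb`. [cite: ONeill1983, Ch. 3, p. 58 and pp. 90–91] -/
def comap (hpb : contMDiff_pullbackBilin I M I' N n)
    (f : N → M) (hf : ContMDiff I' I (n + 1) f)
    (hf' : ∀ y, Function.Injective (mfderiv I' I f y))
    (hdim : Module.finrank ℝ E' = Module.finrank ℝ E)
    (g : PseudoRiemannianMetric I n E (TangentSpace I : M → Type _)) :
    PseudoRiemannianMetric I' n E' (TangentSpace I' : N → Type _) where
  val := pullbackBilin (I := I) (I' := I') f g.val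
  symm y v w := pullbackBilin_symm f g.val g.symm y v w
  nondegenerate y v hv := by
    apply hf' y
    rw [map_zero]
    refine g.nondegenerate (f y) _ fun w ↦ ?_
    obtain ⟨w', rfl⟩ := (mfderiv_bijective_of_injective (hf' y) hdim).2 w
    simpa using hv w'
  contMDiff := hpb f hf g

/-- The pullback metric at `y` is `f^* g` at `y`. [folklore] -/
@[simp]
lemma val_comap
    (hpb : contMDiff_pullbackBilin I M I' N n)
    (f : N → M) (hf : ContMDiff I' I (n + 1) f)
    (hf' : ∀ y, Function.Injective (mfderiv I' I f y))
    (hdim : Module.finrank ℝ E' = Module.finrank ℝ E)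
    (g : PseudoRiemannianMetric I n E (TangentSpace I : M → Type _)) (y : N) :
    (g.comap hpb f hf hf' hdim).val y = pullbackBilin (I := I) (I' := I') f g.val y :=
  rfl

/-- By construction `f` is an isometric immersion `(N, f^* g) → (M, g)`. O'Neill 1983, Ch. 3,
p. 90. [cite: ONeill1983, Ch. 3, p. 90] -/
lemma isIsometricImmersion_comap
    (hpb : contMDiff_pullbackBilin I M I' N n)
    (f : N → M) (hf : ContMDiff I' I (n + 1) f)
    (hf' : ∀ y, Function.Injective (mfderiv I' I f y))
    (hdim : Module.finrank ℝ E' = Module.finrank ℝ E)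
    (g : PseudoRiemannianMetric I n E (TangentSpace I : M → Type _)) :
    IsIsometricImmersion (g.comap hpb f hf hf' hdim) g f :=
  ⟨hf.of_le le_self_add, fun _ ↦ rfl⟩

end PseudoRiemannianMetric

namespace LorentzianMetric

variable [FiniteDimensional ℝ E] [FiniteDimensional ℝ E']

/-- The **pullback Lorentzian metric** `f^* g` along a `C^{n+1}` immersion `f : N → M` between
manifolds of the same dimension (a local diffeomorphism, e.g. an open embedding or a covering
map). Since every `df_y` is a linear isometry onto `(T_{f y} M, g_{f y})`, the signature
`(−,+,…,+)` is inherited. O'Neill 1983, Ch. 3, pp. 58, 90–91 (semi-Riemannian coverings);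
Hawking–Ellis 1973, §3.1. [cite: ONeill1983, Ch. 3, pp. 58, 90–91] -/
def comap (hpb : PseudoRiemannianMetric.contMDiff_pullbackBilin I M I' N n)
    (f : N → M) (hf : ContMDiff I' I (n + 1) f)
    (hf' : ∀ y, Function.Injective (mfderiv I' I f y))
    (hdim : Module.finrank ℝ E' = Module.finrank ℝ E) (g : LorentzianMetric I n M) :
    LorentzianMetric I' n N where
  toPseudoRiemannianMetric := g.toPseudoRiemannianMetric.comap hpb f hf hf' hdim
  exists_timelike y := by
    obtain ⟨v, hv⟩ := g.exists_timelike (f y)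
    refine ⟨(mfderivEquivOfInjective (I := I) (I' := I') f y (hf' y) hdim).symm v, ?_⟩
    simpa using hv
  pos_of_orthogonal y v w hv hvw hw := by
    simp only [PseudoRiemannianMetric.val_comap, pullbackBilin_apply] at hv hvw ⊢
    exact g.pos_of_orthogonal (f y) _ _ hv hvw fun h ↦ hw (hf' y (by rw [h, map_zero]))

/-- The pullback Lorentzian metric at `y` is `f^* g` at `y`. [folklore] -/
@[simp]
lemma val_comap (hpb : PseudoRiemannianMetric.contMDiff_pullbackBilin I M I' N n)
    (f : N → M) (hf : ContMDiff I' I (n + 1) f)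
    (hf' : ∀ y, Function.Injective (mfderiv I' I f y))
    (hdim : Module.finrank ℝ E' = Module.finrank ℝ E) (g : LorentzianMetric I n M) (y : N) :
    (g.comap hpb f hf hf' hdim).val y = pullbackBilin (I := I) (I' := I') f g.val y :=
  rfl

/-- Causal character is preserved: `v` is timelike for `f^* g` iff `df v` is timelike for `g`.
O'Neill 1983, Ch. 3, p. 58. [cite: ONeill1983, Ch. 3, p. 58] -/
@[simp]
lemma isTimelike_comap_iff (hpb : PseudoRiemannianMetric.contMDiff_pullbackBilin I M I' N n)
    (f : N → M) (hf : ContMDiff I' I (n + 1) f)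
    (hf' : ∀ y, Function.Injective (mfderiv I' I f y))
    (hdim : Module.finrank ℝ E' = Module.finrank ℝ E) (g : LorentzianMetric I n M) {y : N}
    (v : TangentSpace I' y) :
    (g.comap hpb f hf hf' hdim).IsTimelike v ↔ g.IsTimelike (mfderiv I' I f y v) :=
  Iff.rfl

/-- Causal character is preserved: `v` is causal for `f^* g` iff `df v` is causal for `g`.
O'Neill 1983, Ch. 3, p. 58. [cite: ONeill1983, Ch. 3, p. 58] -/
@[simp]
lemma isCausal_comap_iff (hpb : PseudoRiemannianMetric.contMDiff_pullbackBilin I M I' N n)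
    (f : N → M) (hf : ContMDiff I' I (n + 1) f)
    (hf' : ∀ y, Function.Injective (mfderiv I' I f y))
    (hdim : Module.finrank ℝ E' = Module.finrank ℝ E) (g : LorentzianMetric I n M) {y : N}
    (v : TangentSpace I' y) :
    (g.comap hpb f hf hf' hdim).IsCausal v ↔ g.IsCausal (mfderiv I' I f y v) := by
  simp only [IsCausal, val_comap, pullbackBilin_apply, ne_eq]
  exact and_congr Iff.rfl (not_congr ⟨fun h ↦ by rw [h, map_zero], fun h ↦ hf' y (by
    rw [h, map_zero])⟩)

end LorentzianMetric

namespace TimeOrientation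

variable [FiniteDimensional ℝ E] [FiniteDimensional ℝ E']
variable {g : LorentzianMetric I n M} (τ : TimeOrientation g)

/-- The vector field `f^* T := y ↦ (df_y)⁻¹ (T (f y))` underlying the pulled-back time
orientation along an equidimensional immersion `f`. O'Neill 1983, Ch. 5, p. 145; Ch. 7,
p. 191 (coverings of time-orientable manifolds). [cite: ONeill1983, Ch. 5, p. 145] -/
def comapFun (f : N → M) (hf' : ∀ y, Function.Injective (mfderiv I' I f y))
    (hdim : Module.finrank ℝ E' = Module.finrank ℝ E) (y : N) : TangentSpace I' y :=
  (mfderivEquivOfInjective (I := I) (I' := I') f y (hf' y) hdim).symm (τ.vectorField (f y))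

omit [IsManifold I' ∞ N] in
/-- Defining property of `comapFun`: `df_y ((f^* T) y) = T (f y)`. [folklore] -/
@[simp]
lemma mfderiv_comapFun (f : N → M) (hf' : ∀ y, Function.Injective (mfderiv I' I f y))
    (hdim : Module.finrank ℝ E' = Module.finrank ℝ E) (y : N) :
    mfderiv I' I f y (τ.comapFun f hf' hdim y) = τ.vectorField (f y) :=
  mfderiv_mfderivEquivOfInjective_symm f y (hf' y) hdim _

variable (I' N) in
/-- Smoothness of the pulled-back vector field: if `T` is a `C^n` vector field on `M` and
`f : N → M` is a `C^{n+1}` immersion between equidimensional manifolds (hence a `C^{n+1}` local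
diffeomorphism by the inverse function theorem), then `y ↦ (df_y)⁻¹ (T (f y))` is a `C^n`
vector field on `N`. O'Neill 1983, Ch. 1, pp. 20–21 and Ch. 3, p. 90.  The manifold and
finite-dimensionality hypotheses are part of the statement (`[IsManifold I ∞ M]` is an outer
argument forced by `g`; `[IsManifold I' ∞ N]` and finite-dimensionality are inner instance
binders); `I' N` are explicit. [cite: ONeill1983, Ch. 1, pp. 20–21 and Ch. 3, p. 90] -/
def contMDiff_comapFun : Prop :=
  ∀ [IsManifold I' ∞ N] [FiniteDimensional ℝ E] [FiniteDimensional ℝ E']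
    (f : N → M) (_ : ContMDiff I' I (n + 1) f) (hf' : ∀ y, Function.Injective (mfderiv I' I f y))
    (hdim : Module.finrank ℝ E' = Module.finrank ℝ E),
    ContMDiff I' I'.tangent n
      (fun y ↦ (TotalSpace.mk' E' y (τ.comapFun f hf' hdim y) : TangentBundle I' N))

/-- The **pulled-back time orientation** `f^* T` of the pullback metric `f^* g` along a
`C^{n+1}` immersion between equidimensional manifolds (a local diffeomorphism): the timelike
vector field `y ↦ (df_y)⁻¹ (T (f y))`. With it, `f` preserves time orientation
(`preservesTimeOrientation_comap`). O'Neill 1983, Ch. 5, p. 145 and Ch. 7, p. 191;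
Hawking–Ellis 1973, §3.1 and §6.1 (time-orientable coverings). Smoothness of the pullbacks
(`contMDiff_pullbackBilin`, `contMDiff_comapFun`) are the hypotheses `hpb`, `hcf`. [cite: ONeill1983, Ch. 5, p. 145 and Ch. 7, p. 191] -/
def comap (hpb : PseudoRiemannianMetric.contMDiff_pullbackBilin I M I' N n)
    (hcf : τ.contMDiff_comapFun I' N)
    (f : N → M) (hf : ContMDiff I' I (n + 1) f)
    (hf' : ∀ y, Function.Injective (mfderiv I' I f y))
    (hdim : Module.finrank ℝ E' = Module.finrank ℝ E) :
    TimeOrientation (g.comap hpb f hf hf' hdim) where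
  vectorField := τ.comapFun f hf' hdim
  isTimelike y := by
    rw [LorentzianMetric.isTimelike_comap_iff, mfderiv_comapFun]
    exact τ.isTimelike (f y)
  contMDiff := hcf f hf hf' hdim

/-- The vector field of the pulled-back time orientation. [folklore] -/
@[simp]
lemma vectorField_comap (hpb : PseudoRiemannianMetric.contMDiff_pullbackBilin I M I' N n)
    (hcf : τ.contMDiff_comapFun I' N)
    (f : N → M) (hf : ContMDiff I' I (n + 1) f)
    (hf' : ∀ y, Function.Injective (mfderiv I' I f y))
    (hdim : Module.finrank ℝ E' = Module.finrank ℝ E) (y : N) :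
    (τ.comap hpb hcf f hf hf' hdim).vectorField y = τ.comapFun f hf' hdim y :=
  rfl

/-- `f : (N, f^* g, f^* T) → (M, g, T)` preserves time orientation. O'Neill 1983, Ch. 5,
p. 145. [cite: ONeill1983, Ch. 5, p. 145] -/
lemma preservesTimeOrientation_comap (hpb : PseudoRiemannianMetric.contMDiff_pullbackBilin I M I' N n)
    (hcf : τ.contMDiff_comapFun I' N)
    (f : N → M) (hf : ContMDiff I' I (n + 1) f)
    (hf' : ∀ y, Function.Injective (mfderiv I' I f y))
    (hdim : Module.finrank ℝ E' = Module.finrank ℝ E) :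
    PreservesTimeOrientation f (τ.comap hpb hcf f hf hf' hdim) τ := fun y ↦ by
  rw [vectorField_comap, mfderiv_comapFun]
  exact τ.isFutureDirected_vectorField (f y)

end TimeOrientation

end Comap

end Literature.Geometry.Lorentzian

end
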